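import Summits.ValiantsHypothesis.ValiantsHypothesis.Theorems.LacunarySymmetroidMatrixDescartesPivotArrowTwoKit

/-!
# `MatrixDescartes` (stmt-ValiantsHypothesis-18050) — pivot column at all sizes, GENERIC kit: the scalar model of a
# stacked arrowhead construction whose block shape crosses its level EIGHT times (the `K = 5` column)

HONEST FRAMING.  Cell `pub-symmetroid`, seat `val-sym-mdr-p2` (gen 9); helper file `--supports` the crux
`Theses.LacunarySymmetroid.MatrixDescartes` (OPEN), NO closure claim.  Pure one-variable real analysis, generic in the block
shape: the soft induction of `…PivotArrowSixKit` (gen 8) with EIGHT sign points instead of six: an ABSTRACT shape function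
`φ : ℝ → ℝ` with `φ → 0` at `0` and at `∞` and values `< θ, > θ, < θ, > θ, < θ, > θ, < θ, > θ` at eight points
`p₁ > p₂ > ⋯ > p₈ > 0` (`θ > 0`).  It is instantiated in `…PivotArrowFive` by the `K = 5` balanced arrowhead block on the
support `(3; 0, 2; 5, 19, 291)` (target row: conjb-1's `Pivot.PivotRootLawAt m 5 1 B`).  Nothing here bears on
`MatrixDescartes` in its window, on `stub_twoSided`, `DoorA26` / `DoorA34`, the census registers, or `VP ≠ VNP`.

THE MODEL `M(x) = x⁻³ − 1 + ∑ᵢ Uᵢ φ(x/Ξᵢ)` and THE INDUCTION (`PivotArrowEight.model_alternates`): for every `k` there are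
positive `Ξ, U : Fin k → ℝ` and a strictly decreasing list of `8k + 2` positive points along which `M` has the signs
`−, +, −, …, +` (from the largest point down); step: amplitude `U' := 1/θ`, new scale `Ξ' → ∞`, eight new points `pᵢ Ξ'`,
finitely many eventual strict inequalities (`Filter.eventually_all`).  The limit lemmas and the sign bookkeeping are the
generic ones of `…PivotArrowSixKit` / `…PivotArrowTwoKit` (eight = six + two prepended points).  No quantitative estimate
anywhere.

[folklore] Elementary real analysis over Mathlib.  Axioms `propext`, `Classical.choice`, `Quot.sound`.
-/

set_option linter.dupNamespace false

namespace Summit.ValiantsHypothesis.ValiantsHypothesis.Theorems.LacunarySymmetroidMatrixDescartes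

open scoped BigOperators Topology
open Filter Matrix

namespace PivotArrowEight

/-- The scalar model `M(x) = x⁻³ − 1 + ∑ᵢ Uᵢ φ(x / Ξᵢ)` for a block shape `φ` (local notation, no definition). -/
local notation3 (prettyPrint := false) "M⟦" φ ", " Ξ ", " U "⟧(" x ")" =>
  ((x : ℝ)⁻¹ ^ 3 - 1 + ∑ i, (U : Fin _ → ℝ) i * (φ : ℝ → ℝ) ((x : ℝ) / (Ξ : Fin _ → ℝ) i))

/-! The limit lemmas for the model (`model_snoc`, `model_tendsto_atTop`, `tendsto_newBlock_zero`,
`tendsto_model_newPoint`) are the generic ones of `…PivotArrowSixKit` (namespace `PivotArrowSix`); the sign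
bookkeeping for eight prepended points is `alt_cons₂ ∘ alt_cons₆` / `pos_cons₂ ∘ pos_cons₆`. -/

/-! ## Sign bookkeeping along `vecCons` -/

/-- Prepending eight points with signs `−, +, −, +, −, +, −, +` to an alternating list keeps it alternating.
[bookkeeping] -/
theorem alt_cons₈ {m : ℕ} (f : ℝ → ℝ) (σ : Fin (m + 1) → ℝ) {a b c d e g i l : ℝ}
    (ha : f a < 0) (hb : 0 < f b) (hc : f c < 0) (hd : 0 < f d) (he : f e < 0) (hg : 0 < f g)
    (hi : f i < 0) (hl : 0 < f l)
    (hσ : ∀ j : Fin (m + 1), 0 < (-1 : ℝ) ^ ((j : ℕ) + 1) * f (σ j)) :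
    ∀ j : Fin (m + 1 + 1 + 1 + 1 + 1 + 1 + 1 + 1 + 1),
      0 < (-1 : ℝ) ^ ((j : ℕ) + 1) *
        f (vecCons a (vecCons b (vecCons c (vecCons d (vecCons e (vecCons g (vecCons i (vecCons l σ))))))) j) :=
  PivotArrowTwo.alt_cons₂ f _ ha hb (PivotArrowSix.alt_cons₆ f σ hc hd he hg hi hl hσ)

/-- All entries positive after prepending eight positive points. [bookkeeping] -/
theorem pos_cons₈ {m : ℕ} (σ : Fin (m + 1) → ℝ) {a b c d e g i l : ℝ}
    (ha : 0 < a) (hb : 0 < b) (hc : 0 < c) (hd : 0 < d) (he : 0 < e) (hg : 0 < g) (hi : 0 < i) (hl : 0 < l)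
    (hσ : ∀ j, 0 < σ j) :
    ∀ j : Fin (m + 1 + 1 + 1 + 1 + 1 + 1 + 1 + 1 + 1),
      0 < (vecCons a (vecCons b (vecCons c (vecCons d (vecCons e (vecCons g (vecCons i (vecCons l σ))))))) j) :=
  PivotArrowTwo.pos_cons₂ _ ha hb (PivotArrowSix.pos_cons₆ σ hc hd he hg hi hl hσ)

/-! ## The induction step -/

section Step

variable (φ : ℝ → ℝ) (hφ0 : Tendsto φ (𝓝 0) (𝓝 0)) (hφinf : Tendsto φ atTop (𝓝 0))
  {θ p₁ p₂ p₃ p₄ p₅ p₆ p₇ p₈ : ℝ} (hθ : 0 < θ)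
  (h87 : p₈ < p₇) (h76 : p₇ < p₆) (h65 : p₆ < p₅) (h54 : p₅ < p₄) (h43 : p₄ < p₃) (h32 : p₃ < p₂)
  (h21 : p₂ < p₁) (hp8 : 0 < p₈)
  (s₁ : φ p₁ < θ) (s₂ : θ < φ p₂) (s₃ : φ p₃ < θ) (s₄ : θ < φ p₄) (s₅ : φ p₅ < θ) (s₆ : θ < φ p₆)
  (s₇ : φ p₇ < θ) (s₈ : θ < φ p₈)

include hφ0 hφinf hθ h87 h76 h65 h54 h43 h32 h21 hp8 s₁ s₂ s₃ s₄ s₅ s₆ s₇ s₈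

/-- **One more block.**  Given positive scales `Ξ : Fin k → ℝ`, amplitudes `U`, and a strictly decreasing list `σ` of
positive points along which the model alternates `−, +, −, …` (from the largest point), there are `Ξ', U' > 0` such
that the extended model (new block of scale `Ξ'`, amplitude `U' = 1/θ`) alternates along the list extended by the eight
points `p₁Ξ' > ⋯ > p₈Ξ'` on top. [folklore] -/
theorem step {k m : ℕ} (Ξ U : Fin k → ℝ) (hΞ : ∀ i, 0 < Ξ i)
    (σ : Fin (m + 1) → ℝ) (hanti : StrictAnti σ) (hpos : ∀ j, 0 < σ j)
    (hsign : ∀ j : Fin (m + 1), 0 < (-1 : ℝ) ^ ((j : ℕ) + 1) * M⟦φ, Ξ, U⟧(σ j)) :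
    ∃ Ξ' U' : ℝ, 0 < Ξ' ∧ 0 < U' ∧
      StrictAnti (vecCons (p₁ * Ξ') (vecCons (p₂ * Ξ') (vecCons (p₃ * Ξ') (vecCons (p₄ * Ξ')
        (vecCons (p₅ * Ξ') (vecCons (p₆ * Ξ') (vecCons (p₇ * Ξ') (vecCons (p₈ * Ξ') σ)))))))) ∧
      (∀ j, 0 < (vecCons (p₁ * Ξ') (vecCons (p₂ * Ξ') (vecCons (p₃ * Ξ') (vecCons (p₄ * Ξ')
        (vecCons (p₅ * Ξ') (vecCons (p₆ * Ξ') (vecCons (p₇ * Ξ') (vecCons (p₈ * Ξ') σ)))))))) j) ∧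
      ∀ j : Fin (m + 1 + 1 + 1 + 1 + 1 + 1 + 1 + 1 + 1), 0 < (-1 : ℝ) ^ ((j : ℕ) + 1) *
        M⟦φ, Fin.snoc Ξ Ξ', Fin.snoc U U'⟧((vecCons (p₁ * Ξ') (vecCons (p₂ * Ξ') (vecCons (p₃ * Ξ')
          (vecCons (p₄ * Ξ') (vecCons (p₅ * Ξ') (vecCons (p₆ * Ξ') (vecCons (p₇ * Ξ')
          (vecCons (p₈ * Ξ') σ)))))))) j) := by
  obtain ⟨U', hU'⟩ : ∃ U' : ℝ, U' = 1 / θ := ⟨_, rfl⟩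
  have hU'pos : 0 < U' := by rw [hU']; positivity
  -- (E1) old points keep their signs
  have E1 : ∀ j : Fin (m + 1), ∀ᶠ Ξ' : ℝ in atTop,
      0 < (-1 : ℝ) ^ ((j : ℕ) + 1) * (M⟦φ, Ξ, U⟧(σ j) + U' * φ (σ j / Ξ')) := by
    intro j
    have ht : Tendsto (fun Ξ' : ℝ => (-1 : ℝ) ^ ((j : ℕ) + 1) * (M⟦φ, Ξ, U⟧(σ j) + U' * φ (σ j / Ξ')))
        atTop (𝓝 ((-1 : ℝ) ^ ((j : ℕ) + 1) * (M⟦φ, Ξ, U⟧(σ j) + 0))) :=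
      ((PivotArrowSix.tendsto_newBlock_zero φ hφ0 (σ j) U').const_add _).const_mul _
    rw [add_zero] at ht
    exact ht.eventually_const_lt (hsign j)
  -- (E2) the new points
  have E2 : ∀ y : ℝ, 0 < y → ∀ c : ℝ, c < -1 + U' * φ y →
      ∀ᶠ Ξ' : ℝ in atTop, c < M⟦φ, Ξ, U⟧(y * Ξ') + U' * φ (y * Ξ' / Ξ') := by
    intro y hy c hc
    have ht : Tendsto (fun Ξ' : ℝ => M⟦φ, Ξ, U⟧(y * Ξ') + U' * φ (y * Ξ' / Ξ')) atTop
        (𝓝 (-1 + U' * φ y)) := by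
      refine ((PivotArrowSix.tendsto_model_newPoint φ hφinf Ξ U hΞ hy).add_const (U' * φ y)).congr' ?_
      filter_upwards [eventually_gt_atTop (0 : ℝ)] with Ξ' hΞ'
      rw [mul_div_cancel_right₀ y hΞ'.ne']
    exact ht.eventually_const_lt hc
  have E2' : ∀ y : ℝ, 0 < y → ∀ c : ℝ, -1 + U' * φ y < c →
      ∀ᶠ Ξ' : ℝ in atTop, M⟦φ, Ξ, U⟧(y * Ξ') + U' * φ (y * Ξ' / Ξ') < c := by
    intro y hy c hc
    have ht : Tendsto (fun Ξ' : ℝ => M⟦φ, Ξ, U⟧(y * Ξ') + U' * φ (y * Ξ' / Ξ')) atTop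
        (𝓝 (-1 + U' * φ y)) := by
      refine ((PivotArrowSix.tendsto_model_newPoint φ hφinf Ξ U hΞ hy).add_const (U' * φ y)).congr' ?_
      filter_upwards [eventually_gt_atTop (0 : ℝ)] with Ξ' hΞ'
      rw [mul_div_cancel_right₀ y hΞ'.ne']
    exact ht.eventually_lt_const hc
  -- the signs of the eight limiting values: `-1 + φ(p)/θ`
  have key : ∀ p : ℝ, -1 + U' * φ p = (φ p - θ) / θ := by
    intro p
    rw [hU']
    field_simp
    ring
  have t₁ : -1 + U' * φ p₁ < 0 := by rw [key]; exact div_neg_of_neg_of_pos (by linarith) hθ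
  have t₂ : (0 : ℝ) < -1 + U' * φ p₂ := by rw [key]; exact div_pos (by linarith) hθ
  have t₃ : -1 + U' * φ p₃ < 0 := by rw [key]; exact div_neg_of_neg_of_pos (by linarith) hθ
  have t₄ : (0 : ℝ) < -1 + U' * φ p₄ := by rw [key]; exact div_pos (by linarith) hθ
  have t₅ : -1 + U' * φ p₅ < 0 := by rw [key]; exact div_neg_of_neg_of_pos (by linarith) hθ
  have t₆ : (0 : ℝ) < -1 + U' * φ p₆ := by rw [key]; exact div_pos (by linarith) hθ
  have t₇ : -1 + U' * φ p₇ < 0 := by rw [key]; exact div_neg_of_neg_of_pos (by linarith) hθ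
  have t₈ : (0 : ℝ) < -1 + U' * φ p₈ := by rw [key]; exact div_pos (by linarith) hθ
  have hp7 : 0 < p₇ := hp8.trans h87
  have hp6 : 0 < p₆ := hp7.trans h76
  have hp5 : 0 < p₅ := hp6.trans h65
  have hp4 : 0 < p₄ := hp5.trans h54
  have hp3 : 0 < p₃ := hp4.trans h43
  have hp2 : 0 < p₂ := hp3.trans h32
  have hp1 : 0 < p₁ := hp2.trans h21
  -- collect finitely many eventual facts and pick `Ξ'`
  obtain ⟨Ξ', hΞ'pos, hΞ'big, hold, hn1, hn2, hn3, hn4, hn5, hn6, hn7, hn8⟩ :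
      ∃ Ξ' : ℝ, 0 < Ξ' ∧ σ 0 / p₈ < Ξ' ∧
        (∀ j : Fin (m + 1), 0 < (-1 : ℝ) ^ ((j : ℕ) + 1) * (M⟦φ, Ξ, U⟧(σ j) + U' * φ (σ j / Ξ'))) ∧
        M⟦φ, Ξ, U⟧(p₁ * Ξ') + U' * φ (p₁ * Ξ' / Ξ') < 0 ∧
        0 < M⟦φ, Ξ, U⟧(p₂ * Ξ') + U' * φ (p₂ * Ξ' / Ξ') ∧
        M⟦φ, Ξ, U⟧(p₃ * Ξ') + U' * φ (p₃ * Ξ' / Ξ') < 0 ∧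
        0 < M⟦φ, Ξ, U⟧(p₄ * Ξ') + U' * φ (p₄ * Ξ' / Ξ') ∧
        M⟦φ, Ξ, U⟧(p₅ * Ξ') + U' * φ (p₅ * Ξ' / Ξ') < 0 ∧
        0 < M⟦φ, Ξ, U⟧(p₆ * Ξ') + U' * φ (p₆ * Ξ' / Ξ') ∧
        M⟦φ, Ξ, U⟧(p₇ * Ξ') + U' * φ (p₇ * Ξ' / Ξ') < 0 ∧
        0 < M⟦φ, Ξ, U⟧(p₈ * Ξ') + U' * φ (p₈ * Ξ' / Ξ') := by
    have hall : ∀ᶠ Ξ' : ℝ in atTop, 0 < Ξ' ∧ σ 0 / p₈ < Ξ' ∧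
        (∀ j : Fin (m + 1), 0 < (-1 : ℝ) ^ ((j : ℕ) + 1) * (M⟦φ, Ξ, U⟧(σ j) + U' * φ (σ j / Ξ'))) ∧
        M⟦φ, Ξ, U⟧(p₁ * Ξ') + U' * φ (p₁ * Ξ' / Ξ') < 0 ∧
        0 < M⟦φ, Ξ, U⟧(p₂ * Ξ') + U' * φ (p₂ * Ξ' / Ξ') ∧
        M⟦φ, Ξ, U⟧(p₃ * Ξ') + U' * φ (p₃ * Ξ' / Ξ') < 0 ∧
        0 < M⟦φ, Ξ, U⟧(p₄ * Ξ') + U' * φ (p₄ * Ξ' / Ξ') ∧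
        M⟦φ, Ξ, U⟧(p₅ * Ξ') + U' * φ (p₅ * Ξ' / Ξ') < 0 ∧
        0 < M⟦φ, Ξ, U⟧(p₆ * Ξ') + U' * φ (p₆ * Ξ' / Ξ') ∧
        M⟦φ, Ξ, U⟧(p₇ * Ξ') + U' * φ (p₇ * Ξ' / Ξ') < 0 ∧
        0 < M⟦φ, Ξ, U⟧(p₈ * Ξ') + U' * φ (p₈ * Ξ' / Ξ') := by
      refine (eventually_gt_atTop 0).and ((eventually_gt_atTop _).and ((eventually_all.2 E1).and
        ((E2' p₁ hp1 0 t₁).and ((E2 p₂ hp2 0 t₂).and ((E2' p₃ hp3 0 t₃).and ((E2 p₄ hp4 0 t₄).and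
          ((E2' p₅ hp5 0 t₅).and ((E2 p₆ hp6 0 t₆).and ((E2' p₇ hp7 0 t₇).and (E2 p₈ hp8 0 t₈))))))))))
    exact hall.exists
  have hσ0 : σ 0 < p₈ * Ξ' := by
    have := (div_lt_iff₀ hp8).1 hΞ'big
    linarith
  refine ⟨Ξ', U', hΞ'pos, hU'pos, ?_, ?_, ?_⟩
  · -- strictly decreasing
    exact StrictAnti.vecCons (StrictAnti.vecCons (StrictAnti.vecCons (StrictAnti.vecCons
      (StrictAnti.vecCons (StrictAnti.vecCons (StrictAnti.vecCons (StrictAnti.vecCons hanti hσ0)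
      (mul_lt_mul_of_pos_right h87 hΞ'pos)) (mul_lt_mul_of_pos_right h76 hΞ'pos))
      (mul_lt_mul_of_pos_right h65 hΞ'pos)) (mul_lt_mul_of_pos_right h54 hΞ'pos))
      (mul_lt_mul_of_pos_right h43 hΞ'pos)) (mul_lt_mul_of_pos_right h32 hΞ'pos))
      (mul_lt_mul_of_pos_right h21 hΞ'pos)
  · exact pos_cons₈ σ (mul_pos hp1 hΞ'pos) (mul_pos hp2 hΞ'pos) (mul_pos hp3 hΞ'pos) (mul_pos hp4 hΞ'pos)
      (mul_pos hp5 hΞ'pos) (mul_pos hp6 hΞ'pos) (mul_pos hp7 hΞ'pos) (mul_pos hp8 hΞ'pos) hpos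
  · refine alt_cons₈ (fun x => M⟦φ, Fin.snoc Ξ Ξ', Fin.snoc U U'⟧(x)) σ ?_ ?_ ?_ ?_ ?_ ?_ ?_ ?_ ?_
    · rw [PivotArrowSix.model_snoc]; simpa using hn1
    · rw [PivotArrowSix.model_snoc]; simpa using hn2
    · rw [PivotArrowSix.model_snoc]; simpa using hn3
    · rw [PivotArrowSix.model_snoc]; simpa using hn4
    · rw [PivotArrowSix.model_snoc]; simpa using hn5
    · rw [PivotArrowSix.model_snoc]; simpa using hn6
    · rw [PivotArrowSix.model_snoc]; simpa using hn7
    · rw [PivotArrowSix.model_snoc]; simpa using hn8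
    · intro j
      rw [PivotArrowSix.model_snoc]
      exact hold j

/-- **THE SCALAR MODEL ALTERNATES `8k + 2` TIMES.**  For every `k` there are positive scales and amplitudes
`Ξ, U : Fin k → ℝ` and a strictly decreasing list of `8k + 2` positive points along which the model
`x⁻³ − 1 + ∑ᵢ Uᵢ φ(x/Ξᵢ)` has the signs `−, +, −, +, …, +` (from the largest point down). [folklore] -/
theorem model_alternates (k : ℕ) :
    ∃ (Ξ U : Fin k → ℝ) (σ : Fin (8 * k + 1 + 1) → ℝ), (∀ i, 0 < Ξ i) ∧ (∀ i, 0 < U i) ∧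
      StrictAnti σ ∧ (∀ j, 0 < σ j) ∧
      ∀ j : Fin (8 * k + 1 + 1), 0 < (-1 : ℝ) ^ ((j : ℕ) + 1) * M⟦φ, Ξ, U⟧(σ j) := by
  induction k with
  | zero =>
    refine ⟨Fin.elim0, Fin.elim0, ![2, 1 / 2], fun i => i.elim0, fun i => i.elim0, ?_, ?_, ?_⟩
    · refine StrictAnti.vecCons (strictAnti_vecEmpty) ?_
      show (1 : ℝ) / 2 < 2
      norm_num
    · intro j
      fin_cases j <;> simp
    · intro j
      fin_cases j <;> simp <;> norm_num
  | succ k ih =>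
    obtain ⟨Ξ, U, σ, hΞ, hU, hanti, hpos, hsign⟩ := ih
    obtain ⟨Ξ', U', hΞ', hU', hanti', hpos', hsign'⟩ :=
      step φ hφ0 hφinf hθ h87 h76 h65 h54 h43 h32 h21 hp8 s₁ s₂ s₃ s₄ s₅ s₆ s₇ s₈ Ξ U hΞ σ hanti hpos hsign
    refine ⟨Fin.snoc Ξ Ξ', Fin.snoc U U', vecCons (p₁ * Ξ') (vecCons (p₂ * Ξ') (vecCons (p₃ * Ξ')
      (vecCons (p₄ * Ξ') (vecCons (p₅ * Ξ') (vecCons (p₆ * Ξ') (vecCons (p₇ * Ξ') (vecCons (p₈ * Ξ') σ))))))),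
      ?_, ?_, hanti', hpos', hsign'⟩
    · intro i
      refine Fin.lastCases ?_ (fun i => ?_) i
      · simpa using hΞ'
      · simpa using hΞ i
    · intro i
      refine Fin.lastCases ?_ (fun i => ?_) i
      · simpa using hU'
      · simpa using hU i

end Step

end PivotArrowEight

end Summit.ValiantsHypothesis.ValiantsHypothesis.Theorems.LacunarySymmetroidMatrixDescartes
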